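import Summits.Ventures.PercRepro.C025ProfileGirthHallSuccE
import Summits.Ventures.PercRepro.C025ProfileGirthPredHallB
import Summits.Ventures.PercRepro.C025ProfileThinSimplificationRows
import Summits.Ventures.PercRepro.C025ProfileHallOne

/-!
# THE GIRTH TABLE OF THE ROWS OF `(Π)` AND `(H⁺)` — every `q` (night-3 g19)

The rows `q ≤ 1` hold on every finite matroid (`hallIneq_zero`, `hallIneq_one_all`, `profileIneq_of_hallIneq`), so the
restriction `2 ≤ q` of `hallIneq_of_girth_every` / `profileIneq_of_girth_every` can be dropped:
* **`hallIneq_of_girth_table`** / **`profileIneq_of_girth_table`** `(q u) (hqu : q < u) (hg : ∀ T ⊆ M.E, T.encard + 1 ≤ u →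
  M.Indep T)` — C-033 / C-032 at EVERY row `(q, u)`, `q < u`, on every finite matroid of girth `≥ u` (every set of at
  most `u − 1` points independent), every rank;
* **`hallIneq_of_girth_pred_table`** / **`profileIneq_of_girth_pred_table`** `(q u) (hqu : q + 3 ≤ u) (hg : ∀ T ⊆ M.E,
  T.encard + 2 ≤ u → M.Indep T)` — the rows `q ≤ u − 3` at girth `≥ u − 1`, every rank (the same statements as parts
  B / D of the girth-`(u−1)` chain, collected here next to the girth-`u` ones).
No `def`, no `instance`, no notation.  Axioms: standard.
-/

open scoped Matroid

namespace PercRepro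

open Set Finset ThmH Staged

namespace GirthRows

variable {α : Type} [DecidableEq α] {M : Matroid α} [M.Finite]

/-- C-033 at every row `(q, u)`, `q < u`, on every finite matroid of girth `≥ u`, every `q`. -/
theorem hallIneq_of_girth_table (q u : ℕ) (hqu : q < u)
    (hg : ∀ T ⊆ M.E, T.encard + 1 ≤ u → M.Indep T) : Profile.HallIneq M q u := by
  rcases Nat.lt_or_ge q 2 with hq | hq
  · rcases Nat.lt_or_ge q 1 with h0 | h1
    · have hq0 : q = 0 := by omega
      subst hq0
      exact ThinGirth.hallIneq_zero u
    · have hq1 : q = 1 := by omega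
      subst hq1
      exact hallIneq_one_all M u (by omega)
  · exact hallIneq_of_girth_every q u hq hqu hg

/-- C-032 at every row `(q, u)`, `q < u`, on every finite matroid of girth `≥ u`, every `q`. -/
theorem profileIneq_of_girth_table (q u : ℕ) (hqu : q < u)
    (hg : ∀ T ⊆ M.E, T.encard + 1 ≤ u → M.Indep T) : Profile.ProfileIneq M q u :=
  profileIneq_of_hallIneq q u (hallIneq_of_girth_table q u hqu hg)

/-- C-033 at every row `(q, u)`, `q + 3 ≤ u`, on every finite matroid of girth `≥ u − 1`. -/
theorem hallIneq_of_girth_pred_table (q u : ℕ) (hqu : q + 3 ≤ u)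
    (hg : ∀ T ⊆ M.E, T.encard + 2 ≤ u → M.Indep T) : Profile.HallIneq M q u :=
  hallIneq_of_girth_pred_every q u hqu hg

/-- C-032 at every row `(q, u)`, `q + 3 ≤ u`, on every finite matroid of girth `≥ u − 1`. -/
theorem profileIneq_of_girth_pred_table (q u : ℕ) (hqu : q + 3 ≤ u)
    (hg : ∀ T ⊆ M.E, T.encard + 2 ≤ u → M.Indep T) : Profile.ProfileIneq M q u :=
  profileIneq_of_hallIneq q u (hallIneq_of_girth_pred_table q u hqu hg)

end GirthRows

end PercRepro
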